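import Summits.BirchSwinnertonDyer.BirchSwinnertonDyer.Theorems.AdditiveKolyvaginRoadInductionOfLevelSystemsDict
import Summits.BirchSwinnertonDyer.BirchSwinnertonDyer.Theorems.AdditiveKolyvaginRoadLocalDictionaries
import Summits.BirchSwinnertonDyer.BirchSwinnertonDyer.Theorems.AdditiveKolyvaginRoadChebOfMcCallum
import Summits.BirchSwinnertonDyer.BirchSwinnertonDyer.Theorems.AdditiveKolyvaginRoadLocalPackage
import HarnessLib

/-!
# Route `AdditiveKolyvaginRoad`, crux `KolyvaginPrimitiveAdditive` (item stmt-BirchSwinnertonDyer-20132):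
# S2-ENGINE at a general prime `p`, LOCAL–GLOBAL LAYER — W. Zhang's induction above the bottom from a
# `LevelKolyvaginSystemP`, a `KolyvaginLocalPackageP`, (A1) and odd `p`-Selmer rank `≥ 3`, NO OTHER INPUT
# (cell `pub/bsd-wall`, lead prover `bsd-wall-akr-p1` g3; `--supports stmt-BirchSwinnertonDyer-20132`, helper;
# p-generic port of zhang3-p1's `Theorems/KolyvaginRoadThreeMethod2InductionOfLevelSystemsLocalGlobal.lean`)

WHY THIS FILE. The last layer of the proof of stub ENGINE (`stub_inductionOfLevelSystemsAdditive`) of skeleton v7 of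
crux 20132: the dictionary layer `inductionOfLevelSystemsP_of_dictionaries` (p530880) with the apparatus SUPPLIED IN
THE KERNEL — the genuine localisations `loc_v := galoisCohomology.localization (E[p]) v 1` as `ZMod p`-linear maps
(`AddMonoidHom.toZModLinearMap`), the places `λ = (ℓ)`, `v_q = (q)` of the (inert) Kolyvagin ∕ Bertolini–Darmon
admissible primes, the eigenspaces, the per-place conditions `Kum` ∕ `Tor` ∕ `Tr` and the level structure `L n` (Kummer
at the infinite places and above no level prime, TORIC above the level primes) with their dictionaries
(`AdditiveKolyvaginRoadLocalDictionaries`, p529508), (Cheb) ×2 from McCallum's Cor. 3.2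
(`AdditiveKolyvaginRoadChebOfMcCallum`) — and the level-system-free local–global inputs READ OFF a
`KolyvaginLocalPackageP` (`AdditiveKolyvaginRoadLocalPackage`, p527353): its bilinear forms `b`, `reciprocity`,
`isoKummer`, `isoToric` (above admissible primes — exactly where the level structure is toric), `isoTransverse`, `perf`,
`line`, `supply`.

WHAT. `inductionOfLevelSystemsP_of_localPackage`: at a frame (`K` imaginary quadratic, `p` odd, `ρ̄_{E,p}` onto,
`c ≠ 1`), a `LevelKolyvaginSystemP S` + a `KolyvaginLocalPackageP Lp` + (A1) + `dim_𝔽_p Sel_p(E/K)` odd `≥ 3` ⟹ a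
non-zero Kolyvagin class of the frame with Kolyvagin-prime support. CONDITIONAL on `S`, `Lp`, (A1) only.

HONEST FRAMING: one theorem; 0 definitions, 0 named facts, 0 `sorry`; closes nothing by itself (the registered stub
ENGINE is its frame-quantified, `Nat.card`-currency restatement, landed separately).

References: [cite: WZhang2014, §8.1, Lemma 8.1, Lemma 8.2, Lemma 8.4, §9 proof of Thm. 9.1] [cite: McCallumLMS1991,
Prop. 3.1, Cor. 3.2, Lemma 5.3] [cite: MilneADT2006, Ch. I, Cor. 2.3, Thm. 4.10] [cite: PoonenRains2012, Prop. 4.10].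
-/

-- single-conjunct summit: `Summit.BirchSwinnertonDyer.BirchSwinnertonDyer.…` repeats the name by design
set_option linter.dupNamespace false

noncomputable section

open scoped Classical

namespace Summit.BirchSwinnertonDyer.BirchSwinnertonDyer.Theorems.AdditiveKoly

open WeierstrassCurve NumberField IsDedekindDomain
  Literature.NumberTheory.EllipticCurves Literature.NumberTheory.EllipticCurves.ModularForms
  Literature.NumberTheory.GaloisRepresentations Module
open Summit.BirchSwinnertonDyer.Rank1Residual.X11b.Three.Koly.Method2

variable (W : WeierstrassCurve ℚ) (K : Type) [Field K] [NumberField K] (p : ℕ)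
variable [W.IsElliptic] [W.IsGloballyMinimal] [NeZero (W.conductorNorm ℤ)] [Fact p.Prime]
  (Dt : ModularParametrizationData W (W.conductorNorm ℤ)) (β : ℤ) (ι : K →+* ℂ) (c : K ≃ₐ[ℚ] K)
  [Module (ZMod p) (Vp W K p)]
  [∀ v : Place K, Module (ZMod p)
    (galoisCohomology (((W.baseChange K).torsionGaloisModule ((p ^ 1 : ℕ) : ℤ)).toLocal v) 1)]

/-- **S2-ENGINE at a general prime from the two packages.** At a frame (`K` imaginary quadratic, `p` odd, `ρ̄_{E,p}`
onto, `c ≠ 1`): a `LevelKolyvaginSystemP S`, a `KolyvaginLocalPackageP Lp`, (A1) rank lowering for the canonical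
spaces (the landed stub A1's body), `dim_𝔽_p Sel_p(E/K)` odd and `≥ 3` ⟹ some Kolyvagin class of the frame is
non-zero. Proof: the dictionary layer over the genuine localisations and the places `(ℓ)`, `(q)`, with the
level-system-free inputs read off `Lp` and (Cheb) ×2 from McCallum's Cor. 3.2. [cite: WZhang2014, §9 proof of
Thm. 9.1, Lemma 8.4, §8.1] [cite: MilneADT2006, Ch. I, Thm. 4.10] [cite: McCallumLMS1991, Cor. 3.2] -/
theorem inductionOfLevelSystemsP_of_localPackage (hp2 : p ≠ 2) (hK : IsImaginaryQuadratic K)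
    (hsurj : W.HasSurjectiveModNGaloisRep p) (hc : c ≠ 1)
    (S : LevelKolyvaginSystemP W K p Dt β ι c) (Lp : KolyvaginLocalPackageP W K p ι c)
    (hA1 : ∀ (n : Finset (AdmQ W K p)) (μ : Bool) (x : Vp W K p),
      x ∈ SelQP W K p c n μ → x ≠ 0 →
      ∃ q : AdmQ W K p, q ∉ n ∧
        x ∉ SelQP W K p c (insert q n) μ ∧
        SelQP W K p c (insert q n) μ ≤ SelQP W K p c n μ ∧
        finrank (ZMod p) (SelQP W K p c (insert q n) μ) + 1 = finrank (ZMod p) (SelQP W K p c n μ) ∧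
        SelQP W K p c (insert q n) (!μ) = SelQP W K p c n (!μ))
    (hodd : Odd (finrank (ZMod p)
      (AddSubgroup.toZModSubmodule p (selmerGroup (W.baseChange K) ((p ^ 1 : ℕ) : ℤ)))))
    (h3 : 3 ≤ finrank (ZMod p)
      (AddSubgroup.toZModSubmodule p (selmerGroup (W.baseChange K) ((p ^ 1 : ℕ) : ℤ)))) :
    ∃ (n : ℕ) (d : KolyvaginHeegnerData Dt β ι n),
      KolyvaginDescent.KolSupp (Zhang2014.IsKolyvaginPrime (W.conductorNorm ℤ) W K p) n ∧
        d.kolyvaginClass (Fact.out : p.Prime) 1 ≠ 0 := by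
  -- the concrete apparatus: genuine localisations (as `ZMod p`-linear maps), places, eigenspaces, local conditions
  let ρ := (W.baseChange K).torsionGaloisModule ((p ^ 1 : ℕ) : ℤ)
  let loc : (v : Place K) → Vp W K p →ₗ[ZMod p] galoisCohomology (ρ.toLocal v) 1 := fun v ↦
    (show Vp W K p →+ galoisCohomology (ρ.toLocal v) 1 from galoisCohomology.localization ρ v 1).toZModLinearMap p
  have hloc : ∀ (v : Place K) (x : Vp W K p), loc v x = galoisCohomology.localization ρ v 1 x := fun _ _ ↦ rfl
  let plK : {ℓ // Zhang2014.IsKolyvaginPrime (W.conductorNorm ℤ) W K p ℓ} → HeightOneSpectrum (𝓞 K) := fun ℓ ↦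
    ⟨Ideal.span {((ℓ : ℕ) : 𝓞 K)}, ℓ.2.2.2.2.2.1, by
      rw [Ne, Ideal.span_singleton_eq_bot]; exact_mod_cast ℓ.2.1.ne_zero⟩
  have hplK : ∀ ℓ, ((ℓ : ℕ) : 𝓞 K) ∈ (plK ℓ).asIdeal := fun ℓ ↦ Ideal.mem_span_singleton_self _
  let plQ : AdmQ W K p → HeightOneSpectrum (𝓞 K) := fun q ↦
    ⟨Ideal.span {((q : ℕ) : 𝓞 K)}, q.2.2.2.1, by
      rw [Ne, Ideal.span_singleton_eq_bot]; exact_mod_cast q.2.1.ne_zero⟩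
  have hplQ : ∀ q, ((q : ℕ) : 𝓞 K) ∈ (plQ q).asIdeal := fun q ↦ Ideal.mem_span_singleton_self _
  -- uniqueness of the place above an inert Kolyvagin prime
  have hKuniq : ∀ (ℓ : {ℓ // Zhang2014.IsKolyvaginPrime (W.conductorNorm ℤ) W K p ℓ}) (v : HeightOneSpectrum (𝓞 K)),
      ((ℓ : ℕ) : 𝓞 K) ∈ v.asIdeal → v = plK ℓ := by
    intro ℓ v hv
    have hle : Ideal.span {((ℓ : ℕ) : 𝓞 K)} ≤ v.asIdeal := by
      rw [Ideal.span_le, Set.singleton_subset_iff]; exact hv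
    have hmax := (plK ℓ).isPrime.isMaximal (plK ℓ).ne_bot
    exact HeightOneSpectrum.ext ((hmax.eq_of_le v.isPrime.ne_top hle).symm)
  let E : Bool → Submodule (ZMod p) (Vp W K p) := fun s ↦
    AddSubgroup.toZModSubmodule p (conjAct W c ((p ^ 1 : ℕ) : ℤ) - sgnP s • AddMonoidHom.id (Vp W K p)).ker
  have hE : ∀ (s : Bool) (x : Vp W K p), x ∈ E s ↔ conjAct W c ((p ^ 1 : ℕ) : ℤ) x = sgnP s • x :=
    fun s x ↦ mem_eigenSubmoduleP_iff W K p c s x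
  let Kum : (v : Place K) → Submodule (ZMod p) (galoisCohomology (ρ.toLocal v) 1) := fun v ↦
    AddSubgroup.toZModSubmodule p ((W.baseChange K).kummerLocalConditionAt ((p ^ 1 : ℕ) : ℤ) (Place.Completion v))
  let Tor : (v : HeightOneSpectrum (𝓞 K)) → Submodule (ZMod p) (galoisCohomology (ρ.toLocal (Sum.inr v)) 1) :=
    fun v ↦ Submodule.map (loc (Sum.inr v))
      (AddSubgroup.toZModSubmodule p (toricLocalKer (W.baseChange K) (v.adicCompletion K) ((p ^ 1 : ℕ) : ℤ)))
  let Tr : (ℓ : {ℓ // Zhang2014.IsKolyvaginPrime (W.conductorNorm ℤ) W K p ℓ}) →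
      Submodule (ZMod p) (galoisCohomology (ρ.toLocal (Sum.inr (plK ℓ))) 1) := fun ℓ ↦
    Submodule.map (loc (Sum.inr (plK ℓ))) (AddSubgroup.toZModSubmodule p (transverseLocalKerP W K p ι ℓ (plK ℓ)))
  let L : Finset (AdmQ W K p) → (v : Place K) → Submodule (ZMod p) (galoisCohomology (ρ.toLocal v) 1) :=
    fun n v ↦ match v with
      | Sum.inl w => Kum (Sum.inl w)
      | Sum.inr v' => if ∃ q ∈ n, ((q : ℕ) : 𝓞 K) ∈ v'.asIdeal then Tor v' else Kum (Sum.inr v')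
  -- per-place dictionaries for the genuine localisations
  have hZero : ∀ (v : HeightOneSpectrum (𝓞 K)) (x : Vp W K p),
      x ∈ (W.baseChange K).torsionLocalKer (v.adicCompletion K) ((p ^ 1 : ℕ) : ℤ) ↔ loc (Sum.inr v) x = 0 :=
    fun v x ↦ mem_torsionLocalKer_iff_localization_eq_zero_P W K p v x
  have hKumFin : ∀ (v : HeightOneSpectrum (𝓞 K)) (x : Vp W K p),
      x ∈ selmerLocalKer (W.baseChange K) (v.adicCompletion K) ((p ^ 1 : ℕ) : ℤ) ↔
        loc (Sum.inr v) x ∈ Kum (Sum.inr v) := by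
    intro v x
    rw [AddSubgroup.mem_toZModSubmodule]
    exact mem_selmerLocalKer_iff_localization_mem_kummer_P W K p v x
  have hKumInf : ∀ (w : InfinitePlace K) (x : Vp W K p),
      x ∈ selmerLocalKer (W.baseChange K) w.Completion ((p ^ 1 : ℕ) : ℤ) ↔ loc (Sum.inl w) x ∈ Kum (Sum.inl w) := by
    intro w x
    rw [AddSubgroup.mem_toZModSubmodule]
    exact mem_selmerLocalKer_iff_localization_mem_kummer_inf_P W K p w x
  -- a subgroup containing the kernel is the preimage of its image (for the linear `loc`)
  have hmap : ∀ (v : HeightOneSpectrum (𝓞 K)) (H : AddSubgroup (Vp W K p)),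
      (W.baseChange K).torsionLocalKer (v.adicCompletion K) ((p ^ 1 : ℕ) : ℤ) ≤ H → ∀ x : Vp W K p,
      x ∈ H ↔ loc (Sum.inr v) x ∈ Submodule.map (loc (Sum.inr v)) (AddSubgroup.toZModSubmodule p H) := by
    intro v H hH x
    refine ⟨fun hx ↦ Submodule.mem_map_of_mem (by rwa [AddSubgroup.mem_toZModSubmodule]), fun hx ↦ ?_⟩
    obtain ⟨y, hy, hyx⟩ := Submodule.mem_map.mp hx
    rw [AddSubgroup.mem_toZModSubmodule] at hy
    have hk : x - y ∈ (W.baseChange K).torsionLocalKer (v.adicCompletion K) ((p ^ 1 : ℕ) : ℤ) := by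
      rw [hZero, map_sub, hyx, sub_self]
    have := H.add_mem (hH hk) hy
    rwa [sub_add_cancel] at this
  have hTor : ∀ (v : HeightOneSpectrum (𝓞 K)) (x : Vp W K p),
      x ∈ toricLocalKer (W.baseChange K) (v.adicCompletion K) ((p ^ 1 : ℕ) : ℤ) ↔ loc (Sum.inr v) x ∈ Tor v := by
    intro v x
    refine hmap v _ (fun y hy ↦ ?_) x
    -- the zero local class is toric (represented by the zero cocycle)
    change (W.baseChange K).torsionLocMap (v.adicCompletion K) _ y = 0 at hy
    change y ∈ AddSubgroup.comap _ _
    rw [AddSubgroup.mem_comap, hy]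
    exact AddSubgroup.zero_mem _
  have hTr : ∀ (ℓ : {ℓ // Zhang2014.IsKolyvaginPrime (W.conductorNorm ℤ) W K p ℓ}) (x : Vp W K p),
      x ∈ transverseLocalKerP W K p ι ℓ (plK ℓ) ↔ loc (Sum.inr (plK ℓ)) x ∈ Tr ℓ :=
    fun ℓ x ↦ hmap (plK ℓ) _ (torsionLocalKer_le_transverseLocalKerP W K p ι ℓ (plK ℓ)) x
  -- the level structure
  have hLinf : ∀ (n : Finset (AdmQ W K p)) (w : InfinitePlace K), L n (Sum.inl w) = Kum (Sum.inl w) := fun n w ↦ rfl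
  have hLkum : ∀ (n : Finset (AdmQ W K p)) (v : HeightOneSpectrum (𝓞 K)),
      (∀ q ∈ n, ((q : ℕ) : 𝓞 K) ∉ v.asIdeal) → L n (Sum.inr v) = Kum (Sum.inr v) := by
    intro n v hv
    have hneg : ¬ ∃ q ∈ n, ((q : ℕ) : 𝓞 K) ∈ v.asIdeal := fun ⟨q, hq, hqv⟩ ↦ hv q hq hqv
    show (if ∃ q ∈ n, ((q : ℕ) : 𝓞 K) ∈ v.asIdeal then Tor v else Kum (Sum.inr v)) = Kum (Sum.inr v)
    rw [if_neg hneg]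
  have hLtor : ∀ (n : Finset (AdmQ W K p)) (v : HeightOneSpectrum (𝓞 K)), ∀ q ∈ n,
      ((q : ℕ) : 𝓞 K) ∈ v.asIdeal → L n (Sum.inr v) = Tor v := by
    intro n v q hq hqv
    show (if ∃ q ∈ n, ((q : ℕ) : 𝓞 K) ∈ v.asIdeal then Tor v else Kum (Sum.inr v)) = Tor v
    rw [if_pos ⟨q, hq, hqv⟩]
  -- isotropy of the level structure (Kummer everywhere; TORIC above the admissible level primes) and of `Tr`
  have hisoL : ∀ (n : Finset (AdmQ W K p)) (v : Place K), ∀ x ∈ L n v, ∀ y ∈ L n v, Lp.b v x y = 0 := by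
    intro n v x hx y hy
    rcases v with w | v
    · change x ∈ AddSubgroup.toZModSubmodule p _ at hx
      change y ∈ AddSubgroup.toZModSubmodule p _ at hy
      rw [AddSubgroup.mem_toZModSubmodule] at hx hy
      exact Lp.isoKummer (Sum.inl w) x hx y hy
    · by_cases h : ∃ q ∈ n, ((q : ℕ) : 𝓞 K) ∈ v.asIdeal
      · obtain ⟨q, hq, hqv⟩ := h
        rw [hLtor n v q hq hqv] at hx hy
        obtain ⟨x', hx', rfl⟩ := Submodule.mem_map.mp hx
        obtain ⟨y', hy', rfl⟩ := Submodule.mem_map.mp hy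
        rw [AddSubgroup.mem_toZModSubmodule] at hx' hy'
        exact Lp.isoToric q v hqv x' y' hx' hy'
      · push Not at h
        rw [hLkum n v h] at hx hy
        change x ∈ AddSubgroup.toZModSubmodule p _ at hx
        change y ∈ AddSubgroup.toZModSubmodule p _ at hy
        rw [AddSubgroup.mem_toZModSubmodule] at hx hy
        exact Lp.isoKummer (Sum.inr v) x hx y hy
  have hisoT : ∀ (ℓ : {ℓ // Zhang2014.IsKolyvaginPrime (W.conductorNorm ℤ) W K p ℓ}), ∀ x ∈ Tr ℓ, ∀ y ∈ Tr ℓ,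
      Lp.b (Sum.inr (plK ℓ)) x y = 0 := by
    intro ℓ x hx y hy
    obtain ⟨x', hx', rfl⟩ := Submodule.mem_map.mp hx
    obtain ⟨y', hy', rfl⟩ := Submodule.mem_map.mp hy
    rw [AddSubgroup.mem_toZModSubmodule] at hx' hy'
    exact Lp.isoTransverse ℓ ℓ.2 (plK ℓ) (hplK ℓ) x' y' hx' hy'
  -- (Perf) and (Line) in engine currency
  have hperf' : ∀ (ℓ : {ℓ // Zhang2014.IsKolyvaginPrime (W.conductorNorm ℤ) W K p ℓ}) (s : Bool),
      ∀ x ∈ E s, ∀ y ∈ E s, loc (Sum.inr (plK ℓ)) x ∈ Kum (Sum.inr (plK ℓ)) → loc (Sum.inr (plK ℓ)) x ≠ 0 →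
      loc (Sum.inr (plK ℓ)) y ∈ Tr ℓ → loc (Sum.inr (plK ℓ)) y ≠ 0 →
      Lp.b (Sum.inr (plK ℓ)) (loc (Sum.inr (plK ℓ)) x) (loc (Sum.inr (plK ℓ)) y) ≠ 0 := by
    intro ℓ s x hx y hy hxK hx0 hyT hy0
    exact Lp.perf ℓ ℓ.2 (plK ℓ) (hplK ℓ) s x y ((hE s x).mp hx) ((hE s y).mp hy) ((hKumFin _ x).mpr hxK)
      (fun h ↦ hx0 ((hZero _ x).mp h)) ((hTr ℓ y).mpr hyT) (fun h ↦ hy0 ((hZero _ y).mp h))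
  have hline' : ∀ (ℓ : {ℓ // Zhang2014.IsKolyvaginPrime (W.conductorNorm ℤ) W K p ℓ}) (s : Bool),
      ∃ e : galoisCohomology (ρ.toLocal (Sum.inr (plK ℓ))) 1, ∀ x ∈ E s,
      loc (Sum.inr (plK ℓ)) x ∈ Kum (Sum.inr (plK ℓ)) → ∃ a : ZMod p, loc (Sum.inr (plK ℓ)) x = a • e := by
    intro ℓ s
    obtain ⟨e, he⟩ := Lp.line ℓ ℓ.2 (plK ℓ) (hplK ℓ) s
    exact ⟨e, fun x hx hxK ↦ he x ((hE s x).mp hx) ((hKumFin _ x).mpr hxK)⟩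
  -- (REC)
  have hrec : ∀ (x y : Vp W K p) (T : Finset (Place K)), (∀ v, v ∉ T → Lp.b v (loc v x) (loc v y) = 0) →
      ∑ v ∈ T, Lp.b v (loc v x) (loc v y) = 0 := fun x y T hT ↦ Lp.reciprocity x y T hT
  -- (Cheb) ×2 from McCallum's Cor. 3.2
  have hCheb1 := chebOne_of_mcCallum_P W K p c hK hp2 hsurj hc loc plK hplK hZero
  have hCheb2 := chebTwo_of_mcCallum_P W K p c hK hp2 hsurj hc loc E plK hplK hE hZero
  -- (Supply) in engine currency
  have hSupply' : ∀ (n : Finset (AdmQ W K p)), n.Nonempty →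
      ∀ (ℓ : {ℓ // Zhang2014.IsKolyvaginPrime (W.conductorNorm ℤ) W K p ℓ}) (T : Finset _), ℓ ∉ T →
      ∀ s : Bool, ∃ x ∈ E s, x ≠ 0 ∧
        (∀ v : Place K, v ≠ Sum.inr (plK ℓ) → (∀ ℓ' ∈ T, Sum.inr (plK ℓ') ≠ v) → loc v x ∈ L n v) ∧
        ∀ ℓ' ∈ T, loc (Sum.inr (plK ℓ')) x ∈ Tr ℓ' := by
    intro n hn ℓ T hℓT s
    obtain ⟨x, hxs, hx0, hinf, hfin, htr⟩ := Lp.supply n hn ℓ T hℓT s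
    refine ⟨x, (hE s x).mpr hxs, hx0, fun v hv hvT ↦ ?_,
      fun ℓ' hℓ' ↦ (hTr ℓ' x).mp (htr ℓ' hℓ' (plK ℓ') (hplK ℓ'))⟩
    rcases v with w | v
    · show loc (Sum.inl w) x ∈ Kum (Sum.inl w)
      exact (hKumInf w x).mp (hinf w)
    · have hv' : ((ℓ : ℕ) : 𝓞 K) ∉ v.asIdeal := fun h ↦ hv (by rw [hKuniq ℓ v h])
      have hvT' : ∀ ℓ' ∈ T, ((ℓ' : ℕ) : 𝓞 K) ∉ v.asIdeal := fun ℓ' hℓ'T h ↦ hvT ℓ' hℓ'T (by rw [hKuniq ℓ' v h])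
      obtain ⟨hk, ho⟩ := hfin v hv' hvT'
      by_cases h : ∃ q ∈ n, ((q : ℕ) : 𝓞 K) ∈ v.asIdeal
      · obtain ⟨q, hq, hqv⟩ := h
        rw [hLtor n v q hq hqv]; exact (hTor v x).mp (ho q hq hqv)
      · push Not at h
        rw [hLkum n v h]; exact (hKumFin v x).mp (hk h)
  exact inductionOfLevelSystemsP_of_dictionaries W K p Dt β ι c hp2 hK S loc Lp.b E Kum Tor plK plQ Tr L hplK hplQ
    hE hKumInf hKumFin hTor hTr hZero hLinf hLkum hLtor hisoL hisoT hperf' hline' hrec hCheb1 hCheb2 hSupply' hA1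
    hodd h3

end Summit.BirchSwinnertonDyer.BirchSwinnertonDyer.Theorems.AdditiveKoly

end
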